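import Literature.AlgebraicGeometry.HodgeTheory.HodgeLocus
import Literature.AlgebraicGeometry.HodgeTheory.DirectImageCovering
import Literature.AlgebraicGeometry.HodgeTheory.GlobalInvariantCycles
import Literature.AlgebraicGeometry.HodgeTheory.ComplexOrientationFamily
import Literature.AlgebraicGeometry.Motives.FamiliesVHS
import Literature.AlgebraicGeometry.Motives.AlgPoints

/-!
# Route MarkmanPartnerTransport · crux `PicardThreeK3Squares` (stmt-HodgeConjecture-19652) —
# the input structure of the line «maximal-family spread» (definitions only)

Cell hodge-nonav, crux #4 of route MarkmanPartnerTransport (HC⁴(S ⊗ S) for projective K3 surfaces with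
ρ(S) ≥ 3; open core: real multiplication). The crux idea «maximal-family spread» (planner p1 g35, card
attached as item evidence; kernel landed by prover 19652-p1 g7 in
`Theorems/MarkmanPartnerTransportPicardThreeK3SquaresAlgebraicLocusSpread{,Section}`) reduces the
real-multiplication third for ONE surface `S` with generator `t` of `End_Hdg(T(S)_ℚ)` to a single
geometric input, displayed here as a STRUCTURE so that consumers and the cell's index can name it:

`RMSpreadFamily S hS t` — **a spread family for `(S, t)`**: a smooth projective family `g : 𝒳 → B` with
quasi-projective total space over a smooth IRREDUCIBLE quasi-projective base (in the intended instance: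
the fibre-square of the universal family over a neat-level cover of the irreducible component, through
`S`, of the real-multiplication Noether–Lefschetz locus of a lattice-polarised K3 moduli space), a point
`b₁` with `S ⊗ S ≅ 𝒳_{b₁}`, a CONTINUOUS SECTION `σ` of the espace étalé `FiberClass g 4` of `R⁴ g_* ℂ`
(a flat section: the generator class, monodromy-invariant after a finite base change) whose value at
`b₁`, pulled back to `S ⊗ S`, induces `t` as a correspondence `pr₁_*(pr₂^*(–) ∪ γ)`, and a DOMINANT
morphism `c : V → B` from an irreducible separated `ℂ`-scheme locally of finite type (in the intended
instance: the classifying morphism of a maximal explicit family, van Geemen–Schütt 2025 Thm. 1.1 (9),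
(11), Thm. 1.2 (2)) such that the value of `σ` over `c(v)` is an ALGEBRAIC class for every `v ∈ V(ℂ)`
(ibid. §4.8: the generator is induced by the cycle `Γ₁ + Γ₋₁` on every member).

Consumers quantify over it (`Nonempty (RMSpreadFamily S hS t)` is its propositional shadow).

The consumer `RMSpreadFamily.hodgeConjectureFor_square` (proof file
`Theorems/MarkmanPartnerTransportPicardThreeK3SquaresRMSpread`): for `t` rational, killing `N¹H²(S)` and
generating the rational Hodge endomorphisms of `T(S)`, an `RMSpreadFamily S hS t` gives
`HodgeConjectureFor 4 (S ⊗ S)` modulo the named fact `deligne1968_invariantClass_fromTotalSpace`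
(Voisin II Thm. 4.18). Nothing is asserted here: one structure, no instance, no
notation, no axiom, no sorry (one structure). The structure is NOT claimed to be inhabited for any `S` — inhabiting it is
exactly the open input (I1′ universal RM family with flat generator; I2 dominance of a cycle-carrying
family) recorded on the crux. Prover seat hodge-nonav-19652-p1 (gen 7), `--supports stmt-HodgeConjecture-19652`.

References: van Geemen–Schütt, Forum Math. Sigma 13 (2025) e2, §3.4, Thm. 1.1 (9), (11), Thm. 1.2 (2),
§4.8, §5.6, §5.8, Rem. 6.5; Voisin, *Hodge Theory II* (2003), Thm. 4.18, §5.3.1, §7.3.2; Charles–Schnell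
(2014), Prop. 11.3.11; Cattani–Deligne–Kaplan, JAMS 8 (1995), Cor. 1.2 (algebraicity of the RM locus).
-/

set_option linter.dupNamespace false

noncomputable section

namespace Summit.HodgeConjecture.HodgeConjecture.Theorems.MarkmanPartnerTransport

open CategoryTheory MonoidalCategory CartesianMonoidalCategory AlgebraicGeometry
open Literature.AlgebraicGeometry Literature.AlgebraicGeometry.Motives Literature.AlgebraicGeometry.HodgeTheory
open Literature.AlgebraicTopology.SingularHomology

/-- **A spread family for the pair `(S, t)`** (`S` a smooth projective surface, `t` an endomorphism of
`H²(S(ℂ); ℂ)` — in the application a generator of the real-multiplication field of a K3 surface): a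
smooth projective family `family : total ⟶ base` of some relative dimension with quasi-projective total
space over a smooth irreducible quasi-projective base; a complex point `pt₁` of the base with an
isomorphism `fibreIso : S ⊗ S ≅ 𝒳_{pt₁}`; a continuous section `flatSection` of the espace étalé
`FiberClass family 4` of `R⁴ family_* ℂ` (a flat family of degree-`4` fibre classes) whose value at
`pt₁`, transported along `fibreIso`, INDUCES `t`: `t y = pr₁_*(pr₂^* y ∪ γ)` for the complex orientation
family, `γ = fibreIso^*(flatSection pt₁)`; and a dominant morphism `classify : param ⟶ base` from an
irreducible, separated, non-empty `ℂ`-scheme locally of finite type such that the value of `flatSection`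
over `classify v` is an algebraic class (`∈ N²H⁴`) for every complex point `v` of `param`. Intended
instance (NOT constructed in the tree): the fibre square of the universal family over the
real-multiplication component through `S` (level structure; algebraic by Cattani–Deligne–Kaplan), the
generator as flat section, and the classifying morphism of a maximal van Geemen–Schütt family carrying
the generator as the cycle `Γ₁ + Γ₋₁`. [cite: GeemenSchutt2023, §3.4, Thm. 1.1 (9), §4.8 and §5.6]
[cite: VoisinHodgeII2003, §5.3.1 and §7.3.2] [cite: CattaniDeligneKaplan1995JAMS, Cor. 1.2] -/
structure RMSpreadFamily (S : SchemeOver ℂ) (hS : IsSmoothProjective 2 S)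
    (t : complexBetti S (2 * 1) →ₗ[ℂ] complexBetti S (2 * 1)) where
  /-- The base `B` of the family (intended: a neat-level cover of the RM component through `S`). -/
  base : SchemeOver ℂ
  /-- The total space `𝒳` of the family (intended: the fibre square of the universal K3 family). -/
  total : SchemeOver ℂ
  /-- The family `g : 𝒳 ⟶ B`. -/
  family : total ⟶ base
  /-- The relative dimension of the family (`4` in the intended instance; not constrained). -/
  relDim : ℕ
  /-- `g` is a smooth projective family of relative dimension `relDim`. -/
  isSmoothProjectiveFamily : IsSmoothProjectiveFamily family relDim
  /-- The total space is quasi-projective over `ℂ`. -/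
  total_quasiProjective : IsQuasiProjectiveOver total
  /-- The base is quasi-projective over `ℂ`. -/
  base_quasiProjective : IsQuasiProjectiveOver base
  /-- The base is smooth over `ℂ`. -/
  base_smooth : AlgebraicGeometry.Smooth base.hom
  /-- The base is irreducible. -/
  base_irreducible : IrreducibleSpace base.left
  /-- The flat family of degree-`4` fibre classes: a section of the espace étalé of `R⁴ g_* ℂ`. -/
  flatSection : ComplexPoints base → FiberClass family (2 * 2)
  /-- The section is continuous (i.e. flat). -/
  flatSection_continuous : Continuous flatSection
  /-- The section is a section of `FiberClass.pt`. -/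
  flatSection_pt : ∀ b, (flatSection b).pt = b
  /-- The complex point of the base under `S ⊗ S`. -/
  pt₁ : ComplexPoints base
  /-- The identification of `S ⊗ S` with the fibre over `pt₁`. -/
  fibreIso : S ⊗ S ≅ fiberOver family pt₁
  /-- The value of the section at `pt₁`, pulled back to `S ⊗ S`, induces `t` as the correspondence
  `y ↦ pr₁_*(pr₂^* y ∪ γ)` for the complex orientation family. -/
  induces : ∀ y : complexBetti S (2 * 1),
    t y = complexGysin complexOrientationFamily (IsSmoothProjective.tensor_holds hS hS) hS
      (SemiCartesianMonoidalCategory.fst S S) (rfl : 2 * 1 + 2 * 2 + 2 * 2 = 2 * 1 + 2 * (2 + 2))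
      (cupProduct (rfl : 2 * 1 + 2 * 2 = 2 * 1 + 2 * 2)
        (complexBetti.map (SemiCartesianMonoidalCategory.snd S S) (2 * 1) y)
        (complexBetti.map fibreIso.hom (2 * 2) ((flatSection pt₁).clsAt (flatSection_pt pt₁))))
  /-- The parameter scheme `V` of the cycle-carrying family (intended: a maximal vGS family). -/
  param : SchemeOver ℂ
  /-- The classifying morphism `c : V ⟶ B`. -/
  classify : param ⟶ base
  /-- `V` is irreducible. -/
  param_irreducible : IrreducibleSpace param.left
  /-- `V` is separated over `ℂ`. -/
  param_isSeparated : IsSeparated param.hom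
  /-- `V` is locally of finite type over `ℂ`. -/
  param_locallyOfFiniteType : LocallyOfFiniteType param.hom
  /-- `V` has a complex point. -/
  param_nonempty : Nonempty (ComplexPoints param)
  /-- `c` is dominant (dense image). -/
  classify_denseRange : DenseRange classify.left.base
  /-- Over every complex point of `V` the value of the section is an algebraic class. -/
  algebraic_over_param : ∀ v : ComplexPoints param,
    (flatSection (AlgPoints.map classify v)).clsAt (flatSection_pt _) ∈
      algebraicClasses (fiberOver family (AlgPoints.map classify v)) 2

end Summit.HodgeConjecture.HodgeConjecture.Theorems.MarkmanPartnerTransport
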